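import Mathlib
import Summits.MatrixMultiplication.MatrixMultiplication.Theses.SnSubsetDichotomy

/-!
# Sketch — crux JuntaBranch (stmt-MatrixMultiplication-8304), crux-ideate round 1, ideator 1

First lemmas of the idea cards `Ideas/mover-covering-amgm.md` and `Ideas/envelope-stability.md`.
Conventions (tree): `TripleProductProperty S T U` is
`s * s'⁻¹ * (t * t'⁻¹) * (u * u'⁻¹) = 1 → s = s' ∧ t = t' ∧ u = u'`, right quotient sets `Q(X) = X X⁻¹`;
umvirate `U_{I→L} = {σ | ∀ k, σ (I k) = L k}`.
-/

open Literature.Combinatorics.Additive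

set_option linter.dupNamespace false

namespace Summit.MatrixMultiplication.MatrixMultiplication.Cruxes.JuntaBranch.Sketch

open Summit.MatrixMultiplication.MatrixMultiplication.Theses.SnSubsetDichotomy

/-! ## Card `mover-covering-amgm` -/

/-- FIRST LEMMA (card mover-covering-amgm; proved): if the product set `Q(S)·Q(U)` covers every
permutation moving `L k` to `L k'` (`k ≠ k'`) — the MOVER-COVERING property of the block `L` — then
the source supports `A_k(T) = {j | ∃ τ ∈ T, τ j = L k}` are pairwise disjoint. This is the subsets
form of the step "the parts of `H₂` meeting the peeled part of `H₁` are distinct" in BCCGU17 Thm 4.2. -/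
theorem disjoint_sources_of_moverCovering {n t : ℕ} (S T U : Finset (Equiv.Perm (Fin n)))
    (hTPP : TripleProductProperty S T U) (L : Fin t → Fin n) (hL : Function.Injective L)
    (hcov : ∀ k k' : Fin t, k ≠ k' → ∀ q : Equiv.Perm (Fin n), q (L k) = L k' →
      ∃ s ∈ S, ∃ s' ∈ S, ∃ u ∈ U, ∃ u' ∈ U, q = s * s'⁻¹ * (u * u'⁻¹))
    (k k' : Fin t) (hkk : k ≠ k') (j : Fin n)
    (hk : ∃ τ ∈ T, τ j = L k) (hk' : ∃ τ' ∈ T, τ' j = L k') : False := by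
  obtain ⟨τ, hτ, hτj⟩ := hk
  obtain ⟨τ', hτ', hτ'j⟩ := hk'
  have hinv : τ⁻¹ (L k) = j := by
    rw [Equiv.Perm.inv_eq_iff_eq]; exact hτj.symm
  have hq : (τ' * τ⁻¹) (L k) = L k' := by
    rw [Equiv.Perm.mul_apply, hinv, hτ'j]
  obtain ⟨s, hs, s', hs', u, hu, u', hu', hEq⟩ := hcov k k' hkk _ hq
  have key : s' * s⁻¹ * (τ' * τ⁻¹) * (u' * u⁻¹) = 1 := by
    rw [hEq]; group
  obtain ⟨-, hττ, -⟩ := hTPP s' hs' s hs τ' hτ' τ hτ u' hu' u hu key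
  apply hkk
  apply hL
  rw [← hτj, ← hτ'j, hττ]

/-- SECOND LEMMA of the card (statement; elementary AM–GM + pigeonhole, provable now): pairwise
disjoint source supports `A_k(T)` give `∑ |A_k| ≤ n`, the source tuple of `L` ranges over
`∏ A_k` (automatically injective tuples), so some atom `J` has
`|T ∩ U_{J→L}| ≥ |T| / ∏ |A_k| ≥ |T| · (t/n)^t`, i.e. `R_T(J→L) ≥ n^{(t)} (t/n)^t ≈ t^t e^{-t²/2n}`,
which is the NEUTRAL scale `(n^{(t)})^{1/2}` exactly when `t ≈ √n`. -/
def AMGMAtom : Prop :=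
  ∀ n t : ℕ, 0 < t → ∀ T : Finset (Equiv.Perm (Fin n)), T.Nonempty → ∀ L : Fin t → Fin n,
    Function.Injective L →
    (∀ k k' : Fin t, k ≠ k' → ∀ j : Fin n,
        (∃ τ ∈ T, τ j = L k) → (∃ τ' ∈ T, τ' j = L k') → False) →
    ∃ J : Fin t → Fin n, Function.Injective J ∧
      (T.card : ℝ) * ((t : ℝ) / n) ^ t ≤ ((T.filter (fun σ => ∀ k, σ (J k) = L k)).card : ℝ)

/-- The joint-gain predicate of a block `(t; L; I, J, P)`: descending `S, T, U` to the atoms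
`I→L, J→L, P→L` and passing to `S_{n-t}` (item `UmvirateDescent`) multiplies the normalised volume by
at least `e^{c+1}` — literally the inequality in `JuntaBranch`'s conclusion with `n' = n - t`. -/
def JointGain (c : ℝ) {n : ℕ} (S T U : Finset (Equiv.Perm (Fin n))) (t : ℕ)
    (L I J P : Fin t → Fin n) : Prop :=
  Real.exp (c + 1) * ((S.card * T.card * U.card : ℕ) : ℝ) *
      (((n - t).factorial : ℝ) / (n.factorial : ℝ)) ^ ((3 : ℝ) / 2) ≤
    (((S.filter (fun σ => ∀ k, σ (I k) = L k)).card *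
        (T.filter (fun σ => ∀ k, σ (J k) = L k)).card *
        (U.filter (fun σ => ∀ k, σ (P k) = L k)).card : ℕ) : ℝ)

/-- TRANSFER TARGET of the card (`C⁺`, the "lone-bump exclusion" / JB-core): in a near-threshold TPP
triple that is JOINTLY FLAT (no block of size `≤ √n` has joint gain `e^{c+1}`), NO single set has a
super-neutral bump. `JuntaBranch` follows from `LoneBumpExcluded` and `UmvirateDescent` by excluded
middle on "some block has joint gain" (reduction `juntaBranch_of_loneBumpExcluded` below); the point
of the transfer is that `C⁺` has no `n'`, no competitor triple and no extremal function: it is a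
single-level structural exclusion ("a super-neutral fibre of one set cannot be paid for by
anti-concentrated partners"), which is what mover-covering + AM–GM attacks. -/
def LoneBumpExcluded (ε c : ℝ) : Prop :=
  ∃ n₀ : ℕ, ∀ n ≥ n₀, ∀ S T U : Finset (Equiv.Perm (Fin n)), TripleProductProperty S T U →
    (n.factorial : ℝ) ^ ((3 : ℝ) / 2) * Real.exp (-(c * Real.sqrt (n : ℝ))) ≤
        ((S.card * T.card * U.card : ℕ) : ℝ) →
    (∀ t : ℕ, 1 ≤ t → (t : ℝ) ≤ Real.sqrt (n : ℝ) → ∀ L I J P : Fin t → Fin n,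
        Function.Injective L → Function.Injective I → Function.Injective J →
        Function.Injective P → ¬ JointGain c S T U t L I J P) →
    ∀ X : Finset (Equiv.Perm (Fin n)), (X = S ∨ X = T ∨ X = U) → ∀ t : ℕ, 1 ≤ t →
      (t : ℝ) ≤ Real.sqrt (n : ℝ) → ∀ I L : Fin t → Fin n, Function.Injective I →
      Function.Injective L →
      ((X.filter (fun σ => ∀ k, σ (I k) = L k)).card : ℝ) * (n.descFactorial t : ℝ) ≤
        (n : ℝ) ^ ((1 / 2 + ε) * t) * (X.card : ℝ)

/-- REDUCTION (statement; provable now from `UmvirateDescent` + cast arithmetic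
`n - √n ≤ n - t < n` for `1 ≤ t ≤ √n`): the lone-bump exclusion for all `ε, c` gives the crux. -/
def juntaBranch_of_loneBumpExcluded : Prop :=
  UmvirateDescent → (∀ ε : ℝ, 0 < ε → ∀ c : ℝ, 0 < c → LoneBumpExcluded ε c) → JuntaBranch

/-! ## Card `envelope-stability` -/

/-- The extremal function: the largest volume `|S||T||U|` of a TPP triple in `S_m` (a maximum over a
finite set; `≤ (m!)³`). -/
noncomputable def maxVol (m : ℕ) : ℕ :=
  sSup {v : ℕ | ∃ S T U : Finset (Equiv.Perm (Fin m)),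
    TripleProductProperty S T U ∧ v = S.card * T.card * U.card}

/-- A triple at level `n` is `(c+1)`-NEAR-EXTREMAL FROM BELOW if no TPP triple of the `√n` levels
beneath beats `e^{c+1}` times its normalised volume — exactly the negation of `JuntaBranch`'s
conclusion. -/
def NearExtremalBelow (c : ℝ) {n : ℕ} (S T U : Finset (Equiv.Perm (Fin n))) : Prop :=
  ∀ n' : ℕ, (n : ℝ) - Real.sqrt (n : ℝ) ≤ (n' : ℝ) → n' < n →
    (maxVol n' : ℝ) < Real.exp (c + 1) * ((S.card * T.card * U.card : ℕ) : ℝ) *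
      ((n'.factorial : ℝ) / (n.factorial : ℝ)) ^ ((3 : ℝ) / 2)

/-- STABILITY FORM of the crux (card envelope-stability): near-threshold TPP triples that are
near-extremal from below are GLOBAL (no super-neutral bump up to level `√n`). Every triple that is NOT
near-extremal from below satisfies `JuntaBranch`'s conclusion for free (take a maximiser of `maxVol n'`),
so `NearExtremalGlobal ε c` for all `ε, c` is EQUIVALENT to `JuntaBranch` (first lemma below). -/
def NearExtremalGlobal (ε c : ℝ) : Prop :=
  ∃ n₀ : ℕ, ∀ n ≥ n₀, ∀ S T U : Finset (Equiv.Perm (Fin n)), TripleProductProperty S T U →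
    (n.factorial : ℝ) ^ ((3 : ℝ) / 2) * Real.exp (-(c * Real.sqrt (n : ℝ))) ≤
        ((S.card * T.card * U.card : ℕ) : ℝ) →
    NearExtremalBelow c S T U →
    ∀ X : Finset (Equiv.Perm (Fin n)), (X = S ∨ X = T ∨ X = U) → ∀ t : ℕ, 1 ≤ t →
      (t : ℝ) ≤ Real.sqrt (n : ℝ) → ∀ I L : Fin t → Fin n, Function.Injective I →
      Function.Injective L →
      ((X.filter (fun σ => ∀ k, σ (I k) = L k)).card : ℝ) * (n.descFactorial t : ℝ) ≤
        (n : ℝ) ^ ((1 / 2 + ε) * t) * (X.card : ℝ)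

/-- FIRST LEMMA (card envelope-stability; statement, provable now — pure logic plus the fact that
`maxVol n'` is attained by some TPP triple of `S_{n'}`): the stability form is equivalent to the crux. -/
def nearExtremalGlobal_iff_juntaBranch : Prop :=
  (∀ ε : ℝ, 0 < ε → ∀ c : ℝ, 0 < c → NearExtremalGlobal ε c) ↔ JuntaBranch

/-- SECOND LEMMA (card envelope-stability; statement, provable now by finite maximality): WLOG the
partners are INCLUSION-SATURATED relative to `S` — enlarging `T, U` keeps the TPP floor and `S`'s bump
and only strengthens what `JuntaBranch` must deliver; and saturation is a covering identity:
every `g ∉ T` lies in `Q(S)Q(U)T ∪ Q(U)Q(S)T`. -/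
def SaturatedCover : Prop :=
  ∀ n : ℕ, ∀ S T U : Finset (Equiv.Perm (Fin n)), TripleProductProperty S T U → S.Nonempty →
    U.Nonempty → (∀ g ∉ T, ¬ TripleProductProperty S (insert g T) U) →
    ∀ g ∉ T, ∃ s ∈ S, ∃ s' ∈ S, ∃ u ∈ U, ∃ u' ∈ U, ∃ t ∈ T,
      g = s * s'⁻¹ * (u * u'⁻¹) * t ∨ g = u * u'⁻¹ * (s * s'⁻¹) * t

end Summit.MatrixMultiplication.MatrixMultiplication.Cruxes.JuntaBranch.Sketch
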